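import Mathlib.Data.Fintype.Basic
import Mathlib.Data.Nat.Log
import Mathlib.Order.Basic
import Mathlib.Tactic.Ring
import Mathlib.Tactic.Linarith
import Literature.Computability.Complexity.KWProtocol
import HarnessLib

/-!
# Block composition `f ⋄ g`, the strong composition game `KW_f ⊛ KW_g`, and the KRW conjectures

The **block composition** of `f : {0,1}^m → {0,1}` and `g : {0,1}^n → {0,1}` is the function
`f ⋄ g : {0,1}^{m×n} → {0,1}` obtained by applying `g` to every row of an `m × n` matrix `X` and
`f` to the resulting column `a = g(X) ∈ {0,1}^m` of ROW LABELS. Karchmer, Raz and Wigderson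
(1995) conjectured that the formula depth of `f ⋄ g` is roughly `D(f) + D(g)` (the **KRW
conjecture**) and showed that this implies `P ⊄ NC¹`; already the **weak KRW conjecture** — for
every non-constant `f` and every `n` SOME inner `g` on `n` bits has `D(f ⋄ g) ≥ D(f) + n −
O(log(m·n))` — implies `P ⊄ NC¹` (Meir 2023, §1, Conj. 2 and the Proposition after it, folklore).

Meir (2023) isolates one of the two obstacles by the **strong composition game**
`KW_f ⊛ KW_g`: Alice holds `X ∈ (f ⋄ g)⁻¹(1)`, Bob holds `Y ∈ (f ⋄ g)⁻¹(0)`, and they must output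
an ENTRY `(i, j)` with `X_{ij} ≠ Y_{ij}` lying in a ROW whose labels differ, `a_i ≠ b_i`
(Meir 2023, Def. 1 in §1); every protocol for the strong game solves the Karchmer–Wigderson game
of `f ⋄ g`, and Meir's main theorem (Thm. 3.1) is the weak-KRW-type bound
`C(KW_f ⊛ KW_g) ≥ log L(KW_f) − (1 − γ)·m + n − O(log(m·n))` for some `g`, with `γ > 0.04`.

This file provides, over the protocol trees `KWTree` of
`Literature.Computability.Complexity.KWProtocol` (a protocol for a game on `m × n` matrices is a
`KWTree (Fin m × Fin n)`, i.e. its leaves are matrix ENTRIES):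

* `row`, `rowLabels`, `blockComp f g` (the function `f ⋄ g`);
* the relabelling combinator `KWTree.comap` (pre-compose both players' node functions with input
  maps, post-compose the leaves with an output map; `run_comap`, `depth_comap`,
  `leafCount_comap`) and the role swap `KWTree.swap` (`run_swap`);
* `KWTree.SolvesStrong P f g` — `P` solves the strong composition game — and
  `SolvesStrong.solves : P.SolvesStrong f g → P.Solves (blockComp f g)`;
* the OBVIOUS PROTOCOL `KWTree.compose g R Q` (run a `KW_f` protocol `Q` on the label columns,
  Alice announces her label of the row found, then a `KW_g` protocol `R` is run on that row with
  the roles oriented accordingly) with `depth_compose : depth = Q.depth + R.depth + 1` and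
  `solvesStrong_compose` — so the strong game is never harder than `D(f) + D(g) + 1`, and in
  particular it is solvable (anti-vacuity of lower-bound statements about it);
* the converse embedding `solves_comap_liftRows`: a protocol for the strong game yields a `KW_f`
  protocol of the same depth once `g` is non-constant (`C(KW_f ⊛ KW_g) ≥ C(KW_f)`);
* NAMED FACTS (published theorems, stated as `Prop`s to be discharged; CONVENTIONS §4):
  `MeirStrongComposition` (Meir 2023, Thm. 3.1 with the admissible value `γ = 1/25`, the formula
  complexity `L(KW_f)` written as the least leaf count of a protocol tree solving `KW_f`, which is
  its definition in Meir 2023, §2.3) and the classical counting fact `DepthHardFunctionsExist`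
  (Riordan–Shannon 1942 via Karchmer–Wigderson: some `g` on `n` bits has `C(KW_g) ≥ n − log₂ log₂ n
  − O(1)`; Jukna 2012, Thm. 1.23 with Thm. 3.13).

All protocol-complexity inequalities are phrased by quantifying over trees ("for every `P`
solving … there is `Q` solving … with `Q.depth + … ≤ P.depth + …`") rather than through an `sInf`,
as in `KWProtocol.lean`; error terms `O(log(m·n))` are rendered as `c * (Nat.log 2 (m * n) + 1)`
with an existentially quantified constant `c : ℕ`, and `n ≥ 1` is assumed where the informal
statements divide by or take logarithms of `n` (for `n = 0` the composed games are vacuous).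

Sources: M. Karchmer, R. Raz, A. Wigderson, *Super-logarithmic depth lower bounds via the direct
sum in communication complexity*, Comput. Complexity 5 (1995) 191–204, §1; O. Meir, *Toward better
depth lower bounds: a KRW-like theorem for strong composition*, FOCS 2023 / arXiv:2306.00615, §1
(Def. 1, Conj. 1–2, Thm. 1.1, the Proposition "weak KRW ⇒ P ⊄ NC¹"), §2.3 (KW relations,
`L(KW_f)`), §3 (Thm. 3.1); I. Dinur, O. Meir, CCC 2016, §1 (history of the conjecture); S. Jukna,
*Boolean Function Complexity* (2012), Thm. 1.23 (Riordan–Shannon), Thm. 3.13 (Karchmer–Wigderson).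

Deliberately NOT here: the KRW conjectures themselves (open conjectures are route items under
`Summits/`, not Literature; the weak conjecture reads, in this file's vocabulary, "`∃ c, ∀ m n,
1 ≤ n → ∀ f` non-constant, `∃ g, ∀ P : KWTree (Fin m × Fin n)`, `P.Solves (blockComp f g) → ∃ Q :
KWTree (Fin m)`, `Q.Solves f ∧ Q.depth + n ≤ P.depth + c * (Nat.log 2 (m * n) + 1)`"), the
multiplexor relations and (partially) half-duplex protocols of Meir's proof, formula-size (`L`)
versions, the universal relation, and the proof of "weak KRW ⇒ P ⊄ NC¹" (an iterated-composition
construction plus the Karchmer–Wigderson correspondence for `NC¹`).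
-/

namespace Literature.Computability.Complexity

universe u v

/-! ### Matrices, rows, block composition -/

/-- The `i`-th row of an `m × n` Boolean matrix given as a function on `Fin m × Fin n`.
[cite: Meir2023, §2 (notation: `X_i` is the `i`-th row of `X`)] -/
def row {m n : ℕ} (X : Fin m × Fin n → Bool) (i : Fin m) : Fin n → Bool := fun j => X (i, j)

/-- The column of **row labels** `g(X) := (g(X_1), …, g(X_m))` of a matrix `X`.
[cite: Meir2023, §1 (the strings `a = g(X)`, `b = g(Y)`)] -/
def rowLabels {m n : ℕ} (g : (Fin n → Bool) → Bool) (X : Fin m × Fin n → Bool) : Fin m → Bool :=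
  fun i => g (row X i)

/-- The **block composition** `f ⋄ g : {0,1}^{m×n} → {0,1}`, `(f ⋄ g)(X) = f(g(X_1), …, g(X_m))`.
[cite: KarchmerRazWigderson1995, §1; Meir2023, §1 (block-composition)] -/
def blockComp {m n : ℕ} (f : (Fin m → Bool) → Bool) (g : (Fin n → Bool) → Bool) :
    (Fin m × Fin n → Bool) → Bool :=
  fun X => f (rowLabels g X)

/-- Entries of a row. [folklore] -/
@[simp] theorem row_apply {m n : ℕ} (X : Fin m × Fin n → Bool) (i : Fin m) (j : Fin n) :
    row X i j = X (i, j) := rfl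

/-- The `i`-th row label is `g` of the `i`-th row. [folklore] -/
@[simp] theorem rowLabels_apply {m n : ℕ} (g : (Fin n → Bool) → Bool) (X : Fin m × Fin n → Bool)
    (i : Fin m) : rowLabels g X i = g (row X i) := rfl

/-- `(f ⋄ g)(X) = f(g(X))`. [cite: Meir2023, §1] -/
@[simp] theorem blockComp_apply {m n : ℕ} (f : (Fin m → Bool) → Bool) (g : (Fin n → Bool) → Bool)
    (X : Fin m × Fin n → Bool) : blockComp f g X = f (rowLabels g X) := rfl

namespace KWTree

variable {ι : Type u} {κ : Type v}

/-! ### Relabelling and role swap -/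

/-- **Relabelling** of a protocol tree along input maps `φA`, `φB` and an output map `out`: Alice
simulates the tree on `φA a`, Bob on `φB b`, and a leaf `i` is reported as `out i` (used to embed
one game into another: restrictions, hard-wiring, playing on a sub-board). [folklore] -/
def comap (φA φB : (κ → Bool) → (ι → Bool)) (out : ι → κ) : KWTree ι → KWTree κ
  | leaf i => leaf (out i)
  | alice s P Q => alice (fun a => s (φA a)) (comap φA φB out P) (comap φA φB out Q)
  | bob s P Q => bob (fun b => s (φB b)) (comap φA φB out P) (comap φA φB out Q)

/-- Run law of `comap`. [folklore] -/
@[simp] theorem run_comap (φA φB : (κ → Bool) → (ι → Bool)) (out : ι → κ) :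
    ∀ (P : KWTree ι) (a b : κ → Bool), (P.comap φA φB out).run a b = out (P.run (φA a) (φB b))
  | leaf i, a, b => rfl
  | alice s P Q, a, b => by
    simp only [comap, run_alice]
    split <;> exact run_comap φA φB out _ a b
  | bob s P Q, a, b => by
    simp only [comap, run_bob]
    split <;> exact run_comap φA φB out _ a b

/-- `comap` preserves depth. [folklore] -/
@[simp] theorem depth_comap (φA φB : (κ → Bool) → (ι → Bool)) (out : ι → κ) :
    ∀ P : KWTree ι, (P.comap φA φB out).depth = P.depth
  | leaf _ => rfl
  | alice s P Q => by simp only [comap, depth_alice, depth_comap φA φB out P, depth_comap φA φB out Q]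
  | bob s P Q => by simp only [comap, depth_bob, depth_comap φA φB out P, depth_comap φA φB out Q]

/-- `comap` preserves the number of leaves. [folklore] -/
@[simp] theorem leafCount_comap (φA φB : (κ → Bool) → (ι → Bool)) (out : ι → κ) :
    ∀ P : KWTree ι, (P.comap φA φB out).leafCount = P.leafCount
  | leaf _ => rfl
  | alice s P Q => by
    simp only [comap, leafCount_alice, leafCount_comap φA φB out P, leafCount_comap φA φB out Q]
  | bob s P Q => by
    simp only [comap, leafCount_bob, leafCount_comap φA φB out P, leafCount_comap φA φB out Q]

/-- **Role swap**: every Alice node becomes a Bob node with the same bit function and vice versa.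
[folklore] -/
def swap : KWTree ι → KWTree ι
  | leaf i => leaf i
  | alice s P Q => bob s (swap P) (swap Q)
  | bob s P Q => alice s (swap P) (swap Q)

/-- Run law of `swap`: the swapped tree on `(a, b)` plays the original tree on `(b, a)`.
[folklore] -/
@[simp] theorem run_swap : ∀ (P : KWTree ι) (a b : ι → Bool), P.swap.run a b = P.run b a
  | leaf i, a, b => rfl
  | alice s P Q, a, b => by
    simp only [swap, run_bob, run_alice]
    split <;> exact run_swap _ a b
  | bob s P Q, a, b => by
    simp only [swap, run_alice, run_bob]
    split <;> exact run_swap _ a b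

/-- `swap` preserves depth. [folklore] -/
@[simp] theorem depth_swap : ∀ P : KWTree ι, P.swap.depth = P.depth
  | leaf _ => rfl
  | alice s P Q => by simp only [swap, depth_bob, depth_alice, depth_swap P, depth_swap Q]
  | bob s P Q => by simp only [swap, depth_alice, depth_bob, depth_swap P, depth_swap Q]

/-- `swap` preserves the number of leaves. [folklore] -/
@[simp] theorem leafCount_swap : ∀ P : KWTree ι, P.swap.leafCount = P.leafCount
  | leaf _ => rfl
  | alice s P Q => by simp only [swap, leafCount_bob, leafCount_alice, leafCount_swap P, leafCount_swap Q]
  | bob s P Q => by simp only [swap, leafCount_alice, leafCount_bob, leafCount_swap P, leafCount_swap Q]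

/-! ### The strong composition game -/

/-- `P.SolvesStrong f g`: the protocol tree `P` over matrix entries solves the **strong composition
game** `KW_f ⊛ KW_g` — on every `X ∈ (f ⋄ g)⁻¹(1)`, `Y ∈ (f ⋄ g)⁻¹(0)` it outputs an entry `(i, j)`
with `X (i, j) ≠ Y (i, j)` AND `g(X_i) ≠ g(Y_i)`. (For constant `f` or constant `g` the function
`f ⋄ g` is constant and every tree solves the game vacuously, exactly as for `Solves`.)
[cite: Meir2023, Def. 1 (§1) and Def. 12 (§2.3)] -/
def SolvesStrong {m n : ℕ} (P : KWTree (Fin m × Fin n)) (f : (Fin m → Bool) → Bool)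
    (g : (Fin n → Bool) → Bool) : Prop :=
  ∀ X Y : Fin m × Fin n → Bool, blockComp f g X = true → blockComp f g Y = false →
    X (P.run X Y) ≠ Y (P.run X Y) ∧ rowLabels g X (P.run X Y).1 ≠ rowLabels g Y (P.run X Y).1

/-- A protocol for the strong composition game solves the Karchmer–Wigderson game of `f ⋄ g`
("strong composition is stronger than composition"). [cite: Meir2023, §1 (remark after Def. 1)] -/
theorem SolvesStrong.solves {m n : ℕ} {P : KWTree (Fin m × Fin n)} {f : (Fin m → Bool) → Bool}
    {g : (Fin n → Bool) → Bool} (h : P.SolvesStrong f g) : P.Solves (blockComp f g) :=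
  fun X Y hX hY => (h X Y hX hY).1

/-! ### The obvious protocol -/

/-- Play the `KW_g` protocol `R` on row `i` of the two matrices, reporting entry `(i, j)` for
`R`'s answer `j`. [cite: Meir2023, §1 (the obvious protocol, second stage)] -/
def onRow {m n : ℕ} (i : Fin m) (R : KWTree (Fin n)) : KWTree (Fin m × Fin n) :=
  R.comap (fun X => row X i) (fun Y => row Y i) fun j => (i, j)

/-- Run law of `onRow`. [folklore] -/
@[simp] theorem run_onRow {m n : ℕ} (i : Fin m) (R : KWTree (Fin n)) (X Y : Fin m × Fin n → Bool) :
    (onRow i R).run X Y = (i, R.run (row X i) (row Y i)) := by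
  simp [onRow]

/-- `onRow` keeps the depth of the row protocol. [folklore] -/
@[simp] theorem depth_onRow {m n : ℕ} (i : Fin m) (R : KWTree (Fin n)) :
    (onRow i R).depth = R.depth := by
  simp [onRow]

/-- The **obvious protocol** for `KW_f ⊛ KW_g` built from a `KW_f` protocol `Q` and a `KW_g`
protocol `R`: the players run `Q` on the label columns `a = g(X)`, `b = g(Y)` (each player can
evaluate her own labels), reaching a row `i`; Alice announces `a_i`; then `R` is run on the rows
`X_i, Y_i`, with the roles swapped when `a_i = 0` (so that the `1`-input of `g` is always on
`R`'s Alice side). [cite: Meir2023, §1 (the obvious protocol); KarchmerRazWigderson1995, §1] -/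
def compose {m n : ℕ} (g : (Fin n → Bool) → Bool) (R : KWTree (Fin n)) :
    KWTree (Fin m) → KWTree (Fin m × Fin n)
  | leaf i => alice (fun X => g (row X i)) (onRow i R.swap) (onRow i R)
  | alice s P Q => alice (fun X => s (rowLabels g X)) (compose g R P) (compose g R Q)
  | bob s P Q => bob (fun Y => s (rowLabels g Y)) (compose g R P) (compose g R Q)

/-- Depth of the obvious protocol: `D(Q) + D(R) + 1`. [cite: Meir2023, §1] -/
theorem depth_compose {m n : ℕ} (g : (Fin n → Bool) → Bool) (R : KWTree (Fin n)) :
    ∀ Q : KWTree (Fin m), (compose g R Q).depth = Q.depth + R.depth + 1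
  | leaf i => by simp [compose]
  | alice s P Q => by
    simp only [compose, depth_alice, depth_compose g R P, depth_compose g R Q]
    omega
  | bob s P Q => by
    simp only [compose, depth_bob, depth_compose g R P, depth_compose g R Q]
    omega

/-- Run law of the obvious protocol: it ends in the row `i = Q.run a b` found by `Q` on the label
columns, at the entry chosen there by `R` (oriented by Alice's label `a_i`). [cite: Meir2023, §1] -/
theorem run_compose {m n : ℕ} (g : (Fin n → Bool) → Bool) (R : KWTree (Fin n)) :
    ∀ (Q : KWTree (Fin m)) (X Y : Fin m × Fin n → Bool),
      (compose g R Q).run X Y =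
        if g (row X (Q.run (rowLabels g X) (rowLabels g Y))) = true then
          (Q.run (rowLabels g X) (rowLabels g Y),
            R.run (row X (Q.run (rowLabels g X) (rowLabels g Y)))
              (row Y (Q.run (rowLabels g X) (rowLabels g Y))))
        else
          (Q.run (rowLabels g X) (rowLabels g Y),
            R.run (row Y (Q.run (rowLabels g X) (rowLabels g Y)))
              (row X (Q.run (rowLabels g X) (rowLabels g Y))))
  | leaf i, X, Y => by
    by_cases h : g (row X i) = true
    · simp [compose, h]
    · simp [compose, h]
  | alice s P Q, X, Y => by
    by_cases h : s (rowLabels g X) = true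
    · simp only [compose, run_alice, h, if_true]
      exact run_compose g R Q X Y
    · simp only [compose, run_alice, h, Bool.false_eq_true, if_false]
      exact run_compose g R P X Y
  | bob s P Q, X, Y => by
    by_cases h : s (rowLabels g Y) = true
    · simp only [compose, run_bob, h, if_true]
      exact run_compose g R Q X Y
    · simp only [compose, run_bob, h, Bool.false_eq_true, if_false]
      exact run_compose g R P X Y

/-- **The obvious protocol solves the strong composition game**: if `Q` solves `KW_f` and `R`
solves `KW_g` then `compose g R Q` solves `KW_f ⊛ KW_g` (hence `C(KW_f ⊛ KW_g) ≤ C(KW_f) +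
C(KW_g) + 1`; the extra round is Alice's announcement of her label of the row found).
[cite: Meir2023, §1 (the obvious protocol "can be easily modified to output such a row")] -/
theorem solvesStrong_compose {m n : ℕ} {f : (Fin m → Bool) → Bool} {g : (Fin n → Bool) → Bool}
    {Q : KWTree (Fin m)} {R : KWTree (Fin n)} (hQ : Q.Solves f) (hR : R.Solves g) :
    (compose g R Q).SolvesStrong f g := by
  intro X Y hX hY
  rw [blockComp_apply] at hX hY
  have hi := hQ (rowLabels g X) (rowLabels g Y) hX hY
  simp only [rowLabels_apply] at hi
  rw [run_compose]
  by_cases h : g (row X (Q.run (rowLabels g X) (rowLabels g Y))) = true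
  · rw [if_pos h]
    refine ⟨?_, by simpa using hi⟩
    have hb : g (row Y (Q.run (rowLabels g X) (rowLabels g Y))) = false := by
      simpa [h] using hi
    exact hR _ _ h hb
  · rw [if_neg h]
    refine ⟨?_, by simpa using hi⟩
    have ha : g (row X (Q.run (rowLabels g X) (rowLabels g Y))) = false := by
      simpa using h
    have hb : g (row Y (Q.run (rowLabels g X) (rowLabels g Y))) = true := by
      simpa [ha] using hi
    exact fun hXY => hR _ _ hb ha hXY.symm

/-! ### Embedding `KW_f` into the strong game -/

/-- Blow a column `a ∈ {0,1}^m` up to a matrix whose `i`-th row is `u` if `a_i = 1` and `v` if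
`a_i = 0`. [cite: Meir2023, §2.3 (reductions between KW relations)] -/
def liftRows {m n : ℕ} (u v : Fin n → Bool) (a : Fin m → Bool) : Fin m × Fin n → Bool :=
  fun p => if a p.1 = true then u p.2 else v p.2

/-- The row labels of the blown-up matrix are the column it was blown up from. [folklore] -/
theorem rowLabels_liftRows {m n : ℕ} {g : (Fin n → Bool) → Bool} {u v : Fin n → Bool}
    (hu : g u = true) (hv : g v = false) (a : Fin m → Bool) : rowLabels g (liftRows u v a) = a := by
  funext i
  have : row (liftRows u v a) i = if a i = true then u else v := by
    funext j
    by_cases h : a i = true <;> simp [row, liftRows, h]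
  rw [rowLabels_apply, this]
  cases hai : a i <;> simp [hu, hv]

/-- **`C(KW_f ⊛ KW_g) ≥ C(KW_f)` for non-constant `g`**: feeding a strong-game protocol the blown-up
columns `liftRows u v a`, `liftRows u v b` (`g u = 1`, `g v = 0`) and reporting only the row of its
answer solves `KW_f`, in the same depth (`depth_comap`). [cite: Meir2023, §1 (finding a row with
`a_i ≠ b_i` is solving `KW_f`)] -/
theorem solves_comap_liftRows {m n : ℕ} {f : (Fin m → Bool) → Bool} {g : (Fin n → Bool) → Bool}
    {P : KWTree (Fin m × Fin n)} (hP : P.SolvesStrong f g) {u v : Fin n → Bool} (hu : g u = true)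
    (hv : g v = false) : (P.comap (liftRows u v) (liftRows u v) Prod.fst).Solves f := by
  intro a b ha hb
  rw [run_comap]
  have hX : blockComp f g (liftRows u v a) = true := by rw [blockComp_apply, rowLabels_liftRows hu hv]; exact ha
  have hY : blockComp f g (liftRows u v b) = false := by rw [blockComp_apply, rowLabels_liftRows hu hv]; exact hb
  have h2 := (hP _ _ hX hY).2
  rwa [rowLabels_liftRows hu hv, rowLabels_liftRows hu hv] at h2

end KWTree

/-! ### Named facts: Meir's theorem, depth-hard functions -/

/-- **Meir's KRW-like theorem for strong composition** (the admissible instance `γ = 1/25` of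
"some `γ > 0.04`"): there is `c` such that for every non-constant `f : {0,1}^m → {0,1}` and every
`n ≥ 1` some `g : {0,1}^n → {0,1}` makes every protocol tree `P` for `KW_f ⊛ KW_g` satisfy
`log₂ L(KW_f) + n ≤ depth P + (24/25)·m + c·(log₂(m·n) + 1)`, where `L(KW_f)`, the formula
complexity of `KW_f`, is the least number of leaves of a protocol tree solving `KW_f` (so the
statement asks for SOME tree `Q` solving `KW_f` with `⌊log₂ (leafCount Q)⌋` in place of
`log₂ L(KW_f)`, which the optimal tree provides). Informally (Thm. 1.1):
`C(KW_f ⊛ KW_g) ≥ C(KW_f) + n − (1 − γ)·m − O(log(m·n))`. PROVED in the source (named fact, to be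
discharged). [cite: Meir2023, Thm. 3.1 (γ > 0.04) and §2.3 (formula complexity L(KW_f) = least
size of a protocol)] -/
def MeirStrongComposition : Prop :=
  ∃ c : ℕ, ∀ m n : ℕ, 1 ≤ n → ∀ f : (Fin m → Bool) → Bool, (∃ a b, f a ≠ f b) →
    ∃ g : (Fin n → Bool) → Bool, ∀ P : KWTree (Fin m × Fin n), P.SolvesStrong f g →
      ∃ Q : KWTree (Fin m), Q.Solves f ∧
        Nat.log 2 Q.leafCount + n ≤ P.depth + 24 * m / 25 + c * (Nat.log 2 (m * n) + 1)

/-- **Depth-hard functions exist** (Riordan–Shannon counting through the Karchmer–Wigderson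
correspondence): there is `c` such that for every `n ≥ 1` some `g : {0,1}^n → {0,1}` has
`C(KW_g) ≥ n − c·(log₂ n + 1)`, i.e. every protocol tree solving its Karchmer–Wigderson game has
depth at least that. (Riordan–Shannon: almost all `g` need De Morgan formulas of leafsize
`≥ (1 − ε)·2ⁿ/log₂ n`; a depth-`d` protocol for `KW_g` gives a formula of depth `d`, hence of
leafsize `≤ 2^d`.) PROVED in the sources (named fact, to be discharged).
[cite: JuknaBFC2012, Thm. 1.23 (Riordan–Shannon) and Thm. 3.13, Claim 3.15 (protocol to formula)] -/
def DepthHardFunctionsExist : Prop :=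
  ∃ c : ℕ, ∀ n : ℕ, 1 ≤ n → ∃ g : (Fin n → Bool) → Bool,
    ∀ P : KWTree (Fin n), P.Solves g → n ≤ P.depth + c * (Nat.log 2 n + 1)

end Literature.Computability.Complexity
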